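import Mathlib.NumberTheory.LegendreSymbol.JacobiSymbol
import HarnessLib

/-!
# ROUTE U, EVEN members — reciprocity forms of the Kronecker values:
# `(−n/a) = χ₄(a)(a/n)`, `(−2n₀/a) = χ₈'(a)(a/n₀)` / `χ₈(a)(a/n₀)`, `(−m/a)(a/r) = (mr/a)` (`a` odd)

bsd-cm cell (run/shared/lean/pub/bsd-cm/), ROUTE U (Theorem U: BSD(49a1^{(D)}, 7)), seat `bsd-cm-ram`
(g6). The even members `D = −4n` twist `49a1` by the Kronecker character `a ↦ (−n / a)` (odd `a`);
the Bernoulli certificates of the member files evaluate sums of these values with `decide`, which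
needs them as products of `χ₄ / χ₈ / χ₈'` (Mathlib tables mod `4`, `8`) and Euler-criterion Jacobi
symbols `J(a | q)`; the twin `49a1^{(4nr)}` needs the product identity with `(a / r)`. Pure
quadratic reciprocity for Jacobi symbols (Mathlib), no characters:

* `jacobiSym_neg_eq_χ₄_mul` — `J(−n | a) = χ₄(a)·J(a | n)` for `n ≡ 1 (mod 4)`;
* `jacobiSym_neg_two_mul_eq_χ₈'_mul` — `J(−2n₀ | a) = χ₈'(a)·J(a | n₀)` for `n₀ ≡ 1 (mod 4)`;
* `jacobiSym_neg_two_mul_eq_χ₈_mul` — `J(−2n₀ | a) = χ₈(a)·J(a | n₀)` for `n₀ ≡ 3 (mod 4)`;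
* `jacobiSym_neg_mul_jacobiSym_eq` — `J(−m | a)·J(a | r) = J(m·r | a)` for `r ≡ 3 (mod 4)`.

THEOREMS ONLY; no definitions, no named facts; nothing booked.
References: [Cox2013] §1.C Lemma 1.14, (1.15)–(1.18).
-/

open scoped NumberTheorySymbols

namespace Summit.BirchSwinnertonDyer.Rank1Residual.X12.O11.RouteU

/-- **`J(−n | a) = χ₄(a)·J(a | n)`** for `n ≡ 1 (mod 4)` and odd `a` (so the Kronecker character of
`ℚ(√−n)`, `d = −4n`, is `χ₄ · (·/n)`): `J(−n|a) = χ₄(a)J(n|a)` and `J(n|a) = J(a|n)` by reciprocity.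
[cite: Cox2013, §1.C Lemma 1.14 and (1.15)–(1.18)] -/
theorem jacobiSym_neg_eq_χ₄_mul {n a : ℕ} (hn4 : n % 4 = 1) (ha : Odd a) :
    J(-(n : ℤ) | a) = ZMod.χ₄ a * J((a : ℤ) | n) := by
  rw [jacobiSym.neg _ ha, jacobiSym.quadratic_reciprocity_one_mod_four hn4 ha]

/-- **`J(−2n₀ | a) = χ₈'(a)·J(a | n₀)`** for `n₀ ≡ 1 (mod 4)` and odd `a` (the Kronecker character of
`ℚ(√−2n₀)`, `d = −8n₀`, is `χ₈' · (·/n₀)`): `J(−2|a) = χ₈'(a)` and `J(n₀|a) = J(a|n₀)`.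
[cite: Cox2013, §1.C Lemma 1.14 and (1.15)–(1.18)] -/
theorem jacobiSym_neg_two_mul_eq_χ₈'_mul {n₀ a : ℕ} (hn4 : n₀ % 4 = 1) (ha : Odd a) :
    J(-(2 * (n₀ : ℤ)) | a) = ZMod.χ₈' a * J((a : ℤ) | n₀) := by
  rw [show -(2 * (n₀ : ℤ)) = -2 * (n₀ : ℤ) by ring, jacobiSym.mul_left, jacobiSym.at_neg_two ha,
    jacobiSym.quadratic_reciprocity_one_mod_four hn4 ha]

/-- **`J(−2n₀ | a) = χ₈(a)·J(a | n₀)`** for `n₀ ≡ 3 (mod 4)` and odd `a` (the Kronecker character of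
`ℚ(√−2n₀)`, `d = −8n₀`, is `χ₈ · (·/n₀)`): `J(−2n₀|a) = χ₈(a)χ₄(a)J(n₀|a)` and
`χ₄(a)J(n₀|a) = J(a|n₀)` (reciprocity, by `a mod 4`). [cite: Cox2013, §1.C Lemma 1.14 and (1.15)–(1.18)] -/
theorem jacobiSym_neg_two_mul_eq_χ₈_mul {n₀ a : ℕ} (hn4 : n₀ % 4 = 3) (ha : Odd a) :
    J(-(2 * (n₀ : ℤ)) | a) = ZMod.χ₈ a * J((a : ℤ) | n₀) := by
  have hn₀ : Odd n₀ := Nat.odd_iff.mpr (by omega)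
  rw [show -(2 * (n₀ : ℤ)) = 2 * (-(n₀ : ℤ)) by ring, jacobiSym.mul_left, jacobiSym.at_two ha,
    jacobiSym.neg _ ha]
  rcases Nat.odd_mod_four_iff.mp (Nat.odd_iff.mp ha) with h1 | h3
  · rw [ZMod.χ₄_nat_one_mod_four h1, one_mul, jacobiSym.quadratic_reciprocity_one_mod_four' hn₀ h1]
  · rw [ZMod.χ₄_nat_three_mod_four h3, jacobiSym.quadratic_reciprocity_three_mod_four hn4 h3]
    ring

/-- **`J(−m | a)·J(a | r) = J(m·r | a)`** for an odd `r ≡ 3 (mod 4)`, any integer `m` and odd `a`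
(the product of the Kronecker characters of discriminants `4·(−m)`-type and `−r` is that of `4·mr`):
`J(−m|a) = χ₄(a)J(m|a)` and `J(r|a) = χ₄(a)J(a|r)` (reciprocity, `r ≡ 3 (mod 4)`, by `a mod 4`).
[cite: Cox2013, §1.C Lemma 1.14 and (1.15)–(1.18)] -/
theorem jacobiSym_neg_mul_jacobiSym_eq {m : ℤ} {r a : ℕ} (hr4 : r % 4 = 3) (ha : Odd a) :
    J(-m | a) * J((a : ℤ) | r) = J(m * r | a) := by
  have hr : Odd r := Nat.odd_iff.mpr (by omega)
  rw [jacobiSym.neg _ ha, jacobiSym.mul_left]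
  rcases Nat.odd_mod_four_iff.mp (Nat.odd_iff.mp ha) with h1 | h3
  · rw [ZMod.χ₄_nat_one_mod_four h1, one_mul, jacobiSym.quadratic_reciprocity_one_mod_four' hr h1]
  · rw [ZMod.χ₄_nat_three_mod_four h3, jacobiSym.quadratic_reciprocity_three_mod_four hr4 h3]
    ring

end Summit.BirchSwinnertonDyer.Rank1Residual.X12.O11.RouteU
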